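import Mathlib
import HarnessLib

/-!
# Denominators of the quartic hypergeometric approximants (Chen–Voutier Lemma 4 for `n = 4`)

[ChenVoutier1997, §2 Lemma 4 (arXiv:1401.5450 numbering)] ("a generalization of a result of Baker,
itself an improvement of a result of Siegel"): for `j = ±1` and `μ_n = ∏_{p ∣ n} p^{1/(p−1)}`, the
polynomial `C(2r, r) ₂F₁(−r, −r + j/n; −2r; n μ_n X)` has algebraic-integer coefficients; by the printed
computation its coefficient of `(−X)^s` is `C(2r − s, r) · μ_n^s l_s / s!` with
`l_s = ∏_{k = r−s+1}^{r} (kn − j)`, so the content of the lemma is `s! ∣ μ_n^s σ… l_s` (via Chudnovsky's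
Lemma 4.1).  For the quartic case `n = 4` used in [ChenVoutier1997, §3.1] (`μ₄ = 2`, rational
integers), this file PROVES the divisibility in the slightly more general form

`s! ∣ 2^s ∏_{i < s} (4(m + i) + c)`  for all `m, s, c ∈ ℕ`  (`factorial_dvd_two_pow_mul_prod`),

whose instances `c = 3`, `c = 5`, `m = r − s` are `s! ∣ 2^s ∏_{k=r−s+1}^{r} (4k ∓ 1)`
(`factorial_dvd_two_pow_mul_prod_sub_one`, `…_add_one`).  Proof (Legendre-style, as in Chudnovsky's
Lemma 4.1): for an odd prime `p`, `4` is a unit mod `p^a`, so any `p^a` consecutive values of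
`4k + c` contain a multiple of `p^a`; hence a block of `s` consecutive `k` contributes at least
`⌊s/p^a⌋` multiples of `p^a`, and `v_p(∏) ≥ ∑_a ⌊s/p^a⌋ = v_p(s!)`; for `p = 2` the factor `2^s`
suffices since `v_2(s!) ≤ s`.

## References

* Chen Jian Hua, P. M. Voutier, J. Number Theory 62 (1997) 71–99 = arXiv:1401.5450, §2 Lemma 4 and
  its proof; G. V. Chudnovsky, Ann. of Math. 117 (1983), Lemma 4.1. [ChenVoutier1997]
-/

namespace Literature.NumberTheory.DiophantineApproximation

open Finset Nat

/-! ## Counting multiples of `q` among `s` consecutive values of `4k + c` (`q` odd) -/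

/-- For `q` coprime to `4` there is `i₀ < q` with `q ∣ 4(m + i₀) + c`. [folklore] -/
theorem exists_lt_dvd_linear {q : ℕ} (hq : Nat.Coprime 4 q) (hq1 : 1 < q) (m c : ℕ) :
    ∃ i₀, i₀ < q ∧ q ∣ 4 * (m + i₀) + c := by
  haveI : NeZero q := ⟨by omega⟩
  haveI : Fact (1 < q) := ⟨hq1⟩
  set u : (ZMod q)ˣ := ZMod.unitOfCoprime 4 hq with hu
  set z : ZMod q := -((4 * m + c : ℕ) : ZMod q) * (u⁻¹ : (ZMod q)ˣ) with hz
  refine ⟨z.val, ZMod.val_lt z, ?_⟩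
  rw [← ZMod.natCast_eq_zero_iff]
  have hu4 : ((u : (ZMod q)ˣ) : ZMod q) = 4 := by rw [hu]; rfl
  have key : (4 : ZMod q) * z = -((4 * m + c : ℕ) : ZMod q) := by
    rw [hz, ← hu4, mul_comm, mul_assoc, Units.inv_mul, mul_one]
  push_cast at key ⊢
  rw [ZMod.natCast_zmod_val]
  linear_combination key

/-- Among the `s` consecutive values `4(m + i) + c`, `i < s`, at least `⌊s/q⌋` are divisible by `q`
when `q > 1` is coprime to `4`. [folklore] -/
theorem div_le_card_filter_dvd {q : ℕ} (hq : Nat.Coprime 4 q) (hq1 : 1 < q) (m c s : ℕ) :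
    s / q ≤ ((range s).filter fun i => q ∣ 4 * (m + i) + c).card := by
  obtain ⟨i₀, hi₀, hdvd⟩ := exists_lt_dvd_linear hq hq1 m c
  have hqpos : 0 < q := by omega
  -- the injection `t ↦ i₀ + q t` from `range (s / q)` into the filter
  calc s / q = (range (s / q)).card := (card_range _).symm
    _ ≤ ((range s).filter fun i => q ∣ 4 * (m + i) + c).card := by
      refine Finset.card_le_card_of_injOn (fun t => i₀ + q * t) ?_ ?_
      · intro t ht
        rw [mem_coe, mem_range] at ht
        rw [mem_coe, mem_filter, mem_range]
        refine ⟨?_, ?_⟩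
        · -- `i₀ + q t ≤ (q - 1) + q (s/q - 1) < q (s/q) ≤ s`
          have h1 : q * (t + 1) ≤ q * (s / q) := Nat.mul_le_mul_left q ht
          have h2 : q * (s / q) ≤ s := Nat.mul_div_le s q
          nlinarith
        · have : 4 * (m + (i₀ + q * t)) + c = (4 * (m + i₀) + c) + q * (4 * t) := by ring
          rw [this]
          exact dvd_add hdvd (dvd_mul_right q _)
      · intro t₁ _ t₂ _ h
        have := h
        simp only at this
        exact Nat.eq_of_mul_eq_mul_left hqpos (by omega)

/-! ## `p`-adic valuations -/

/-- `v_p(x) ≥ #{a ∈ [1, b) : p^a ∣ x}` for `x ≠ 0`. [folklore] -/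
theorem card_filter_pow_dvd_le_padicValNat {p : ℕ} [hp : Fact p.Prime] {x : ℕ} (hx : x ≠ 0) (b : ℕ) :
    ((Ico 1 b).filter fun a => p ^ a ∣ x).card ≤ padicValNat p x := by
  calc ((Ico 1 b).filter fun a => p ^ a ∣ x).card ≤ (Ico 1 (padicValNat p x + 1)).card := by
        apply card_le_card
        intro a ha
        rw [mem_filter, mem_Ico] at ha
        rw [mem_Ico]
        refine ⟨ha.1.1, Nat.lt_succ_of_le ?_⟩
        exact (padicValNat_dvd_iff_le hx).1 ha.2
    _ = padicValNat p x := by simp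

/-- `v_p` of a product of non-zero naturals is the sum of the `v_p`'s. [folklore] -/
theorem padicValNat_finset_prod {p : ℕ} [hp : Fact p.Prime] {ι : Type*} (S : Finset ι) (f : ι → ℕ)
    (hf : ∀ i ∈ S, f i ≠ 0) : padicValNat p (∏ i ∈ S, f i) = ∑ i ∈ S, padicValNat p (f i) := by
  induction S using Finset.cons_induction with
  | empty => simp
  | cons a S ha ih =>
    rw [prod_cons, sum_cons, padicValNat.mul (hf a (by simp))
      (prod_ne_zero_iff.2 fun i hi => hf i (by simp [hi])), ih fun i hi => hf i (by simp [hi])]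

/-- For an odd prime `p` and `4m + c > 0`: `v_p(s!) ≤ v_p(∏_{i<s} (4(m+i) + c))` — Legendre's formula
against the block count. [cite: ChenVoutier1997, §2 Lemma 4 (arXiv numbering), proof] -/
theorem padicValNat_factorial_le_prod {p : ℕ} [hp : Fact p.Prime] (hp2 : p ≠ 2) (m c s : ℕ)
    (h0 : 0 < 4 * m + c) :
    padicValNat p s.factorial ≤ padicValNat p (∏ i ∈ range s, (4 * (m + i) + c)) := by
  have hcop : ∀ a : ℕ, Nat.Coprime 4 (p ^ a) := by
    intro a
    apply Nat.Coprime.pow_right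
    have h2 : Nat.Coprime 2 p := (Nat.coprime_primes Nat.prime_two hp.out).2 (Ne.symm hp2)
    simpa using Nat.Coprime.pow_left 2 h2
  have hne : ∀ i ∈ range s, 4 * (m + i) + c ≠ 0 := fun i _ => by omega
  -- Legendre
  have hlog : Nat.log p s < s + 1 := Nat.lt_succ_of_le (Nat.log_le_self p s)
  rw [padicValNat_factorial hlog, padicValNat_finset_prod _ _ hne]
  -- `∑_a ⌊s/p^a⌋ ≤ ∑_a #{i : p^a ∣ f i} = ∑_i #{a : p^a ∣ f i} ≤ ∑_i v_p(f i)`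
  calc ∑ a ∈ Ico 1 (s + 1), s / p ^ a
      ≤ ∑ a ∈ Ico 1 (s + 1), ((range s).filter fun i => p ^ a ∣ 4 * (m + i) + c).card := by
        apply sum_le_sum
        intro a ha
        rw [mem_Ico] at ha
        exact div_le_card_filter_dvd (hcop a) (Nat.one_lt_pow (by omega) hp.out.one_lt) m c s
    _ = ∑ i ∈ range s, ((Ico 1 (s + 1)).filter fun a => p ^ a ∣ 4 * (m + i) + c).card := by
        simp only [card_filter]
        exact sum_comm
    _ ≤ ∑ i ∈ range s, padicValNat p (4 * (m + i) + c) := by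
        apply sum_le_sum
        intro i hi
        exact card_filter_pow_dvd_le_padicValNat (hne i hi) _

/-- `v_2(s!) ≤ s`. [folklore] -/
theorem padicValNat_two_factorial_le (s : ℕ) : padicValNat 2 s.factorial ≤ s := by
  have h := sub_one_mul_padicValNat_factorial (p := 2) s
  norm_num at h
  omega

/-- **Chen–Voutier Lemma 4 for `n = 4` (the divisibility content):
`s! ∣ 2^s ∏_{i<s} (4(m + i) + c)` for all `m, s, c`.** [cite: ChenVoutier1997, §2 Lemma 4 (arXiv numbering)] -/
theorem factorial_dvd_two_pow_mul_prod (m s c : ℕ) :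
    s.factorial ∣ 2 ^ s * ∏ i ∈ range s, (4 * (m + i) + c) := by
  rcases Nat.eq_zero_or_pos (4 * m + c) with h0 | h0
  · -- `m = c = 0`: the factor `i = 0` vanishes
    rcases s with _ | s
    · simp
    · have : (∏ i ∈ range (s + 1), (4 * (m + i) + c)) = 0 :=
        prod_eq_zero (i := 0) (by simp) (by omega)
      simp [this]
  · set P := ∏ i ∈ range s, (4 * (m + i) + c) with hP_def
    have hP : P ≠ 0 := prod_ne_zero_iff.2 fun i _ => by omega
    have hN : 2 ^ s * P ≠ 0 := mul_ne_zero (pow_ne_zero _ two_ne_zero) hP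
    rw [← Nat.factorization_le_iff_dvd (Nat.factorial_ne_zero s) hN, Finsupp.le_def]
    intro p
    by_cases hp : p.Prime
    · haveI := Fact.mk hp
      rw [Nat.factorization_def _ hp, Nat.factorization_def _ hp,
        padicValNat.mul (pow_ne_zero _ two_ne_zero) hP, padicValNat.pow 2 s]
      by_cases hp2 : p = 2
      · subst hp2
        have := padicValNat_two_factorial_le s
        simp only [padicValNat_self, mul_one]
        omega
      · have h2 : padicValNat p 2 = 0 :=
          padicValNat.eq_zero_of_not_dvd fun h => hp2 ((Nat.prime_dvd_prime_iff_eq hp Nat.prime_two).1 h)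
        rw [h2, mul_zero, zero_add, hP_def]
        exact padicValNat_factorial_le_prod hp2 m c s h0
    · simp [Nat.factorization_eq_zero_of_not_prime _ hp]

/-- The instance of [ChenVoutier1997, §2 Lemma 4] with `n = 4`, `j = 1`: `s! ∣ 2^s ∏_{k=r−s+1}^{r} (4k − 1)`
(`= 2^s l_s`, `0 ≤ s ≤ r`), i.e. the coefficients `C(2r − s, r)·2^s l_s/s!` of
`C(2r, r) ₂F₁(−r, −r + 1/4; −2r; 8X)` are integers. [cite: ChenVoutier1997, §2 Lemma 4 (arXiv numbering)] -/
theorem factorial_dvd_two_pow_mul_prod_sub_one {r s : ℕ} (hs : s ≤ r) :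
    s.factorial ∣ 2 ^ s * ∏ k ∈ Ico (r - s + 1) (r + 1), (4 * k - 1) := by
  have e : ∏ k ∈ Ico (r - s + 1) (r + 1), (4 * k - 1) = ∏ i ∈ range s, (4 * ((r - s) + i) + 3) := by
    rw [prod_Ico_eq_prod_range, show r + 1 - (r - s + 1) = s by omega]
    exact prod_congr rfl fun i _ => by omega
  rw [e]
  exact factorial_dvd_two_pow_mul_prod (r - s) s 3

/-- The instance with `n = 4`, `j = −1`: `s! ∣ 2^s ∏_{k=r−s+1}^{r} (4k + 1)`, i.e. the coefficients of
`C(2r, r) ₂F₁(−r, −r − 1/4; −2r; 8X)` are integers. [cite: ChenVoutier1997, §2 Lemma 4 (arXiv numbering)] -/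
theorem factorial_dvd_two_pow_mul_prod_add_one {r s : ℕ} (hs : s ≤ r) :
    s.factorial ∣ 2 ^ s * ∏ k ∈ Ico (r - s + 1) (r + 1), (4 * k + 1) := by
  have e : ∏ k ∈ Ico (r - s + 1) (r + 1), (4 * k + 1) = ∏ i ∈ range s, (4 * ((r - s) + i) + 5) := by
    rw [prod_Ico_eq_prod_range, show r + 1 - (r - s + 1) = s by omega]
    exact prod_congr rfl fun i _ => by omega
  rw [e]
  exact factorial_dvd_two_pow_mul_prod (r - s) s 5

end Literature.NumberTheory.DiophantineApproximation
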